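import Summits.ResolutionOfSingularities.ResolutionOfSingularities.Theorems.FrobeniusLadderFInjectiveMacaulayficationRelGddF192ConeData
import Summits.ResolutionOfSingularities.ResolutionOfSingularities.Theorems.FrobeniusLadderFInjectiveMacaulayficationRelGddF192Data
import Summits.ResolutionOfSingularities.ResolutionOfSingularities.Theorems.FrobeniusLadderFInjectiveMacaulayficationRelGddF008ConeData
import Summits.ResolutionOfSingularities.ResolutionOfSingularities.Theorems.FrobeniusLadderFInjectiveMacaulayficationFedderViaSlicingNotMem
import HarnessLib

/-!
# ROWC row F192 at `p = 5`: the CONE clause OFF THE BAD ORBIT `O = {x = y = z = t = 0}`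
# (crux `FInjectiveMacaulayfication` stmt-ResolutionOfSingularities-15315, relative filtered engine v2 `FilteredConeFiModelRelDirect`
# — the `Or.inr` branch of its `hcone`; RULING R16.6 (2) of res-L1-w45a-plan-1)

Support file for crux stmt-ResolutionOfSingularities-15315 (`FrobeniusLadder.FInjectiveMacaulayfication`), chain w45a, seat
res-L1-w45a-stub-4 g6. [OURS · L1 W4.5a; specimen ROWC F192 (res-L1-w45a-idea-2); templates `GxzOffOrigin`, `RelGddF008Cone`] —
NOT a statement of the manuscript; AI-written, weaker than expert review.

`g₀ = z² + t⁴y²w⁴ + (y² + x³)³` (`x,y,z,w,t = X₀,…,X₄`, `φ = y² + x³`), the `(2,3,9,3 | 0)`-weighted tangent cone of F192's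
diagonal form along the `t`-axis, over any field of characteristic `5`.  At a maximal ideal `Q` of `k[X]/(g₀)` missing some `x̄ⱼ`,
`j ∈ {x,y,z,w}`, and NOT containing all of `x̄, ȳ, z̄, t̄` (i.e. off the orbit `O`), the local ring satisfies the Cohen–Macaulay +
Frobenius-closed clause (`g0_offO_clause_char5`):
* some partial `∉ P` ⇒ regular (`ClauseOfPderivNotMem`); else (`∂_z = 2z`, `∂_x = 9x²φ²`, `∂_y = y(2t⁴w⁴ + 6φ²)`,
  `∂_w = 4t⁴y²w³`, `∂_t = 4t³y²w⁴`, `g₀`) the prime `P` contains `z` and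
* EITHER `x, y ∈ P` — then `w ∉ P` (some `x̄ⱼ ∉ Q`) and `t ∉ P` (off `O`): slices `x,y,z`, witness `x⁰y⁴z⁴`, coefficient `6·(t⁴w⁴)²`
  (`RelGddF192ConeData.coeff_S1`; transversal type `z² + c·y²`, an `A`-point);
* OR `φ ∈ P`, `x, y ∉ P` (the case `x ∈ P ∌ y` is contradictory: `4y⁶ ∈ P`), and `t ∈ P` or `w ∈ P` (from `g₀ ∈ P`): slices
  `z,w,t` / `z,t` / `z,w`, witness `z⁴t⁴w⁴` / `z⁴t⁴` / `z⁴w⁴`, coefficient `12y²φ³` / `12y²w⁴φ³` / `12t⁴y²φ³` — a unit AT THE POINT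
  times `φ³`, `∂φ/∂y = 2y ∉ P`: `FedderViaSlicingNotMem.clause_of_sliceCoeff_of_not_mem` (transversal type `z² + φ³ + c·t⁴w⁴`,
  Brieskorn–Pham, F-pure at `5`).
At the points of `O` the cone is NOT F-pure (no monomial of `g₀⁴` survives modulo `(x,y,z,t)^{[5]}`); there the engine's direct
branch takes over (`…RelGddF192Direct`).  No definitions, no named facts. [folklore]
-/

-- single-problem summit: the doubled namespace component is forced
set_option linter.dupNamespace false

noncomputable section

namespace Summit.ResolutionOfSingularities.ResolutionOfSingularities.Theorems.FInjectiveMacaulayfication.RelGddF192Cone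

open MvPolynomial IsLocalRing
open Summit.ResolutionOfSingularities.ResolutionOfSingularities.Theorems.FInjectiveMacaulayfication

set_option maxHeartbeats 800000 in
/-- **THE CONE CLAUSE OFF THE BAD ORBIT for `g₀ = z² + t⁴y²w⁴ + (y² + x³)³` at `p = 5`**: at every maximal ideal `Q` of `k[X]/(g₀)`
missing some `x̄ⱼ` (`j ≤ 3`) and not containing all of `x̄₀, x̄₁, x̄₂, x̄₄`, the local ring satisfies the Cohen–Macaulay +
Frobenius-closed clause. [cite: Fedder1983, Thm. 1.12] [cite: Matsumura1987, Thm. 30.4 (ii)] -/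
theorem g0_offO_clause_char5 (k : Type) [Field k] [CharP k 5] (g₀ : MvPolynomial (Fin 5) k)
    (hg : g₀ = X 2 ^ 2 + X 4 ^ 4 * X 1 ^ 2 * X 3 ^ 4 + (X 1 ^ 2 + X 0 ^ 3) ^ 3) :
    ∀ (Q : Ideal (MvPolynomial (Fin 5) k ⧸ Ideal.span {g₀})) [Q.IsMaximal],
      (∃ j ∈ ({0, 1, 2, 3} : Finset (Fin 5)), Ideal.Quotient.mk (Ideal.span {g₀}) (MvPolynomial.X j) ∉ Q) →
      ¬ (Ideal.Quotient.mk (Ideal.span {g₀}) (MvPolynomial.X 0) ∈ Q ∧ Ideal.Quotient.mk (Ideal.span {g₀}) (MvPolynomial.X 1) ∈ Q ∧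
         Ideal.Quotient.mk (Ideal.span {g₀}) (MvPolynomial.X 2) ∈ Q ∧ Ideal.Quotient.mk (Ideal.span {g₀}) (MvPolynomial.X 4) ∈ Q) →
      ∀ d : ℕ, ringKrullDim (Localization.AtPrime Q) = d → ∀ s : Fin d → Localization.AtPrime Q,
        (Ideal.span (Set.range s)).radical.IsMaximal →
          RingTheory.Sequence.IsWeaklyRegular (Localization.AtPrime Q) (List.ofFn s) ∧
          ∀ y : Localization.AtPrime Q, (∃ e : ℕ, y ^ 5 ^ e ∈ Ideal.span
            ((fun z : Localization.AtPrime Q => z ^ 5 ^ e) ''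
              (Ideal.span (Set.range s) : Set (Localization.AtPrime Q)))) → y ∈ Ideal.span (Set.range s) := by
  haveI : Fact (Nat.Prime 5) := ⟨by norm_num⟩
  intro Q _ hj hO d hd s hs
  haveI hPmax : (Q.comap (Ideal.Quotient.mk (Ideal.span {g₀}))).IsMaximal :=
    Ideal.comap_isMaximal_of_surjective _ Ideal.Quotient.mk_surjective
  have hP := hPmax.isPrime
  have hg0 : g₀ ≠ 0 := hg ▸ RelGddF192Data.g0_ne_zero k
  have hgP : g₀ ∈ Q.comap (Ideal.Quotient.mk (Ideal.span {g₀})) := by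
    rw [Ideal.mem_comap, Ideal.Quotient.eq_zero_iff_mem.mpr (Ideal.mem_span_singleton_self g₀)]
    exact Q.zero_mem
  -- units in characteristic `5`
  have hu2 : IsUnit (2 : MvPolynomial (Fin 5) k) := by simpa using G5wConeClause.isUnit_natCast_of_not_dvd 5 k 2 (by decide)
  have hu4 : IsUnit (4 : MvPolynomial (Fin 5) k) := by simpa using G5wConeClause.isUnit_natCast_of_not_dvd 5 k 4 (by decide)
  have hu9 : IsUnit (9 : MvPolynomial (Fin 5) k) := by simpa using G5wConeClause.isUnit_natCast_of_not_dvd 5 k 9 (by decide)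
  -- partial derivatives
  have hd0 : pderiv 0 g₀ = 9 * X 0 ^ 2 * (X 1 ^ 2 + X 0 ^ 3) ^ 2 := by rw [hg, RelGddF192Data.pderiv_zero_g0]
  have hd1 : pderiv 1 g₀ = 2 * X 4 ^ 4 * X 1 * X 3 ^ 4 + 6 * X 1 * (X 1 ^ 2 + X 0 ^ 3) ^ 2 := by rw [hg, RelGddF192Data.pderiv_one_g0]
  have hd2 : pderiv 2 g₀ = 2 * X 2 := by rw [hg, RelGddF192Data.pderiv_two_g0]
  have hd4 : pderiv 4 g₀ = 4 * X 4 ^ 3 * X 1 ^ 2 * X 3 ^ 4 := by rw [hg, RelGddF192Data.pderiv_four_g0]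
  -- Jacobian exits
  by_cases m2 : pderiv 2 g₀ ∈ Q.comap (Ideal.Quotient.mk (Ideal.span {g₀})); swap
  · exact ClauseOfPderivNotMem.stub_clauseOfPderivNotMem 5 k 5 g₀ Q 2 m2 d hd s hs
  by_cases m0 : pderiv 0 g₀ ∈ Q.comap (Ideal.Quotient.mk (Ideal.span {g₀})); swap
  · exact ClauseOfPderivNotMem.stub_clauseOfPderivNotMem 5 k 5 g₀ Q 0 m0 d hd s hs
  by_cases m1 : pderiv 1 g₀ ∈ Q.comap (Ideal.Quotient.mk (Ideal.span {g₀})); swap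
  · exact ClauseOfPderivNotMem.stub_clauseOfPderivNotMem 5 k 5 g₀ Q 1 m1 d hd s hs
  by_cases m4 : pderiv 4 g₀ ∈ Q.comap (Ideal.Quotient.mk (Ideal.span {g₀})); swap
  · exact ClauseOfPderivNotMem.stub_clauseOfPderivNotMem 5 k 5 g₀ Q 4 m4 d hd s hs
  rw [hd2] at m2
  rw [hd0, mul_assoc] at m0
  rw [hd1] at m1
  rw [hd4, mul_assoc, mul_assoc] at m4
  have hX2 : (X 2 : MvPolynomial (Fin 5) k) ∈ Q.comap (Ideal.Quotient.mk (Ideal.span {g₀})) :=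
    (Ideal.unit_mul_mem_iff_mem _ hu2).mp m2
  -- the element `t⁴y²w⁴ + φ³ = g₀ − z²` lies in `P`
  have hrest : (X 4 ^ 4 * X 1 ^ 2 * X 3 ^ 4 + (X 1 ^ 2 + X 0 ^ 3) ^ 3 : MvPolynomial (Fin 5) k) ∈
      Q.comap (Ideal.Quotient.mk (Ideal.span {g₀})) := by
    have e : (X 4 ^ 4 * X 1 ^ 2 * X 3 ^ 4 + (X 1 ^ 2 + X 0 ^ 3) ^ 3 : MvPolynomial (Fin 5) k) = g₀ - X 2 * X 2 := by rw [hg]; ring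
    rw [e]; exact Ideal.sub_mem _ hgP (Ideal.mul_mem_left _ _ hX2)
  have key : ∀ i : Fin 5, (X i : MvPolynomial (Fin 5) k) ∈ Q.comap (Ideal.Quotient.mk (Ideal.span {g₀})) ↔
      Ideal.Quotient.mk (Ideal.span {g₀}) (X i) ∈ Q := fun i => Ideal.mem_comap
  by_cases hA : (X 0 : MvPolynomial (Fin 5) k) ∈ Q.comap (Ideal.Quotient.mk (Ideal.span {g₀})) ∧
      (X 1 : MvPolynomial (Fin 5) k) ∈ Q.comap (Ideal.Quotient.mk (Ideal.span {g₀}))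
  · /- CASE `x, y, z ∈ P`: then `w ∉ P` (some `x̄ⱼ ∉ Q`) and `t ∉ P` (off `O`); stratum `{x=y=z=0}` -/
    obtain ⟨hX0, hX1⟩ := hA
    have hX3 : (X 3 : MvPolynomial (Fin 5) k) ∉ Q.comap (Ideal.Quotient.mk (Ideal.span {g₀})) := by
      intro h3
      obtain ⟨j, hjJ, hjQ⟩ := hj
      apply hjQ
      simp only [Finset.mem_insert, Finset.mem_singleton] at hjJ
      rcases hjJ with rfl | rfl | rfl | rfl
      · exact (key 0).mp hX0
      · exact (key 1).mp hX1
      · exact (key 2).mp hX2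
      · exact (key 3).mp h3
    have hX4 : (X 4 : MvPolynomial (Fin 5) k) ∉ Q.comap (Ideal.Quotient.mk (Ideal.span {g₀})) :=
      fun h4 => hO ⟨(key 0).mp hX0, (key 1).mp hX1, (key 2).mp hX2, (key 4).mp h4⟩
    obtain ⟨Ψ, hΨ0, hΨ1, hΨ2, hΨ3, hΨ4⟩ := RelGddF192ConeData.exists_xyzSlicing5 k
    have hy0 : Ψ.symm (X 0) = X 0 := Ψ.symm_apply_eq.mpr hΨ0.symm
    have hy1 : Ψ.symm (X 1) = X 1 := Ψ.symm_apply_eq.mpr hΨ1.symm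
    have hy2 : Ψ.symm (X 2) = X 2 := Ψ.symm_apply_eq.mpr hΨ2.symm
    have hb0 : Ψ.symm (C (X 0)) = X 3 := Ψ.symm_apply_eq.mpr hΨ3.symm
    have hb1 : Ψ.symm (C (X 1)) = X 4 := Ψ.symm_apply_eq.mpr hΨ4.symm
    have hy : ∀ r : Fin 3, Ψ.symm (X r) ∈ Q.comap (Ideal.Quotient.mk (Ideal.span {g₀})) := by
      intro r; fin_cases r
      · exact hy0 ▸ hX0
      · exact hy1 ▸ hX1
      · exact hy2 ▸ hX2
    have hΨg : Ψ g₀ = X 2 ^ 2 + (C (X 1 ^ 4 * X 0 ^ 4) * X 1 ^ 2 + (X 1 ^ 2 + X 0 ^ 3) ^ 3) := by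
      rw [hg]; simp only [map_add, map_mul, map_pow, hΨ0, hΨ1, hΨ2, hΨ3, hΨ4]; ring
    have hcoeff : coeff (Finsupp.single (2 : Fin 3) (2 * 2) + Finsupp.single 1 4) (Ψ (g₀ ^ (5 - 1))) =
        6 * (X 1 ^ 4 * X 0 ^ 4) ^ 2 := by
      rw [map_pow, hΨg, show (5 - 1 : ℕ) = 4 from rfl, RelGddF192ConeData.coeff_S1]
    have hu : IsUnit (6 : MvPolynomial (Fin 2) k) := by simpa using G5wConeClause.isUnit_natCast_of_not_dvd 5 k 6 (by decide)
    have hdslice : ∀ r : Fin 3, (Finsupp.single (2 : Fin 3) (2 * 2) + Finsupp.single 1 4 : Fin 3 →₀ ℕ) r < 5 := by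
      intro r; fin_cases r <;> simp
    haveI h𝔭 : ((Q.comap (Ideal.Quotient.mk (Ideal.span {g₀}))).comap (Ψ.symm.toRingHom.comp C)).IsPrime := Ideal.comap_isPrime _ _
    have htw : (X 1 ^ 4 * X 0 ^ 4 : MvPolynomial (Fin 2) k) ∉
        (Q.comap (Ideal.Quotient.mk (Ideal.span {g₀}))).comap (Ψ.symm.toRingHom.comp C) := by
      intro h
      rcases h𝔭.mem_or_mem h with h1 | h0
      · have h1' := Ideal.mem_comap.mp (h𝔭.mem_of_pow_mem 4 h1)
        rw [RingHom.comp_apply, RingEquiv.toRingHom_eq_coe, RingEquiv.coe_toRingHom, hb1] at h1'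
        exact hX4 h1'
      · have h0' := Ideal.mem_comap.mp (h𝔭.mem_of_pow_mem 4 h0)
        rw [RingHom.comp_apply, RingEquiv.toRingHom_eq_coe, RingEquiv.coe_toRingHom, hb0] at h0'
        exact hX3 h0'
    exact FedderViaSlicing.clause_of_sliceCoeff 5 k Ψ g₀ hg0 Q hy _ hdslice _ (X 1 ^ 4 * X 0 ^ 4) hu 2 (by norm_num) hcoeff
      (Or.inl htw) d hd s hs
  · /- CASE not both `x, y ∈ P`: then `φ ∈ P`, `x, y ∉ P`, and `t ∈ P` or `w ∈ P` -/
    have hφ : (X 1 ^ 2 + X 0 ^ 3 : MvPolynomial (Fin 5) k) ∈ Q.comap (Ideal.Quotient.mk (Ideal.span {g₀})) := by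
      rcases hP.mem_or_mem ((Ideal.unit_mul_mem_iff_mem _ hu9).mp m0) with hx | hφ2
      · -- `x ∈ P`: then `y ∉ P`, and `∂_y`, `g₀` give `4y⁶ ∈ P` — contradiction
        exfalso
        have hX0 : (X 0 : MvPolynomial (Fin 5) k) ∈ Q.comap (Ideal.Quotient.mk (Ideal.span {g₀})) := hP.mem_of_pow_mem 2 hx
        have hX1 : (X 1 : MvPolynomial (Fin 5) k) ∉ Q.comap (Ideal.Quotient.mk (Ideal.span {g₀})) := fun h1 => hA ⟨hX0, h1⟩
        have h6 : (4 * X 1 ^ 6 * X 1 : MvPolynomial (Fin 5) k) ∈ Q.comap (Ideal.Quotient.mk (Ideal.span {g₀})) := by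
          have e : (4 * X 1 ^ 6 * X 1 : MvPolynomial (Fin 5) k) =
              X 1 ^ 2 * (2 * X 4 ^ 4 * X 1 * X 3 ^ 4 + 6 * X 1 * (X 1 ^ 2 + X 0 ^ 3) ^ 2)
                - 2 * X 1 * (X 4 ^ 4 * X 1 ^ 2 * X 3 ^ 4 + (X 1 ^ 2 + X 0 ^ 3) ^ 3)
                + X 0 * (2 * X 1 * X 0 ^ 8 - 6 * X 1 ^ 5 * X 0 ^ 2) := by ring
          rw [e]
          exact Ideal.add_mem _ (Ideal.sub_mem _ (Ideal.mul_mem_left _ _ m1) (Ideal.mul_mem_left _ _ hrest))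
            (Ideal.mul_mem_right _ _ hX0)
        rw [mul_assoc] at h6
        rcases hP.mem_or_mem ((Ideal.unit_mul_mem_iff_mem _ hu4).mp h6) with h | h
        · exact hX1 (hP.mem_of_pow_mem 6 h)
        · exact hX1 h
      · exact hP.mem_of_pow_mem 2 hφ2
    have hX0 : (X 0 : MvPolynomial (Fin 5) k) ∉ Q.comap (Ideal.Quotient.mk (Ideal.span {g₀})) := by
      intro hX0
      apply hA
      refine ⟨hX0, hP.mem_of_pow_mem 2 ?_⟩
      have e : (X 1 ^ 2 : MvPolynomial (Fin 5) k) = (X 1 ^ 2 + X 0 ^ 3) - X 0 * X 0 ^ 2 := by ring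
      rw [e]; exact Ideal.sub_mem _ hφ (Ideal.mul_mem_right _ _ hX0)
    have hX1 : (X 1 : MvPolynomial (Fin 5) k) ∉ Q.comap (Ideal.Quotient.mk (Ideal.span {g₀})) := by
      intro hX1
      apply hX0
      refine hP.mem_of_pow_mem 3 ?_
      have e : (X 0 ^ 3 : MvPolynomial (Fin 5) k) = (X 1 ^ 2 + X 0 ^ 3) - X 1 * X 1 := by ring
      rw [e]; exact Ideal.sub_mem _ hφ (Ideal.mul_mem_left _ _ hX1)
    -- `t⁴y²w⁴ ∈ P`, hence `t ∈ P` or `w ∈ P`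
    have htw : (X 4 : MvPolynomial (Fin 5) k) ∈ Q.comap (Ideal.Quotient.mk (Ideal.span {g₀})) ∨
        (X 3 : MvPolynomial (Fin 5) k) ∈ Q.comap (Ideal.Quotient.mk (Ideal.span {g₀})) := by
      have h1 : (X 4 ^ 4 * (X 1 ^ 2 * X 3 ^ 4) : MvPolynomial (Fin 5) k) ∈ Q.comap (Ideal.Quotient.mk (Ideal.span {g₀})) := by
        have e : (X 4 ^ 4 * (X 1 ^ 2 * X 3 ^ 4) : MvPolynomial (Fin 5) k) =
            (X 4 ^ 4 * X 1 ^ 2 * X 3 ^ 4 + (X 1 ^ 2 + X 0 ^ 3) ^ 3) - (X 1 ^ 2 + X 0 ^ 3) ^ 2 * (X 1 ^ 2 + X 0 ^ 3) := by ring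
        rw [e]; exact Ideal.sub_mem _ hrest (Ideal.mul_mem_left _ _ hφ)
      rcases hP.mem_or_mem h1 with h | h
      · exact Or.inl (hP.mem_of_pow_mem 4 h)
      · rcases hP.mem_or_mem h with h' | h'
        · exact absurd (hP.mem_of_pow_mem 2 h') hX1
        · exact Or.inr (hP.mem_of_pow_mem 4 h')
    -- the common Fedder data: `12 ∈ k×`, `∂φ/∂y = 2y`
    have hu12 : ∀ (σ : Type), IsUnit (12 : MvPolynomial σ k) := fun σ => by
      simpa using G5wConeClause.isUnit_natCast_of_not_dvd 5 k 12 (by decide)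
    have hu2' : ∀ (σ : Type), IsUnit (2 : MvPolynomial σ k) := fun σ => by
      simpa using G5wConeClause.isUnit_natCast_of_not_dvd 5 k 2 (by decide)
    by_cases hX4 : (X 4 : MvPolynomial (Fin 5) k) ∈ Q.comap (Ideal.Quotient.mk (Ideal.span {g₀}))
    · by_cases hX3 : (X 3 : MvPolynomial (Fin 5) k) ∈ Q.comap (Ideal.Quotient.mk (Ideal.span {g₀}))
      · /- `z, w, t ∈ P`: plane slicing, witness `z⁴w⁴t⁴`, coefficient `12y²φ³` -/
        obtain ⟨Ψ, hΨ0, hΨ1, hΨ2, hΨ3, hΨ4⟩ := GxzOffOrigin.exists_planeSlicing5 k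
        have hy0 : Ψ.symm (X 0) = X 2 := Ψ.symm_apply_eq.mpr hΨ2.symm
        have hy1 : Ψ.symm (X 1) = X 3 := Ψ.symm_apply_eq.mpr hΨ3.symm
        have hy2 : Ψ.symm (X 2) = X 4 := Ψ.symm_apply_eq.mpr hΨ4.symm
        have hb0 : Ψ.symm (C (X 0)) = X 0 := Ψ.symm_apply_eq.mpr hΨ0.symm
        have hb1 : Ψ.symm (C (X 1)) = X 1 := Ψ.symm_apply_eq.mpr hΨ1.symm
        have hy : ∀ r : Fin 3, Ψ.symm (X r) ∈ Q.comap (Ideal.Quotient.mk (Ideal.span {g₀})) := by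
          intro r; fin_cases r
          · exact hy0 ▸ hX2
          · exact hy1 ▸ hX3
          · exact hy2 ▸ hX4
        have hΨg : Ψ g₀ = X 0 ^ 2 + (C (X 1 ^ 2) * X 2 ^ 4 * X 1 ^ 4 + C ((X 1 ^ 2 + X 0 ^ 3) ^ 3)) := by
          rw [hg]; simp only [map_add, map_mul, map_pow, hΨ0, hΨ1, hΨ2, hΨ3, hΨ4]; ring
        have hcoeff : coeff (Finsupp.single (0 : Fin 3) (2 * 2) + (Finsupp.single 2 4 + Finsupp.single 1 4)) (Ψ (g₀ ^ (5 - 1))) =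
            (12 * X 1 ^ 2) * (X 1 ^ 2 + X 0 ^ 3) ^ 3 := by
          rw [map_pow, hΨg, show (5 - 1 : ℕ) = 4 from rfl, RelGddF192ConeData.coeff_S2a]; ring
        have hdslice : ∀ r : Fin 3, (Finsupp.single (0 : Fin 3) (2 * 2) + (Finsupp.single 2 4 + Finsupp.single 1 4) : Fin 3 →₀ ℕ) r < 5 := by
          intro r; fin_cases r <;> simp
        haveI h𝔭 : ((Q.comap (Ideal.Quotient.mk (Ideal.span {g₀}))).comap (Ψ.symm.toRingHom.comp C)).IsPrime :=
          Ideal.comap_isPrime _ _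
        have hu : (12 * X 1 ^ 2 : MvPolynomial (Fin 2) k) ∉
            (Q.comap (Ideal.Quotient.mk (Ideal.span {g₀}))).comap (Ψ.symm.toRingHom.comp C) := by
          intro h
          have h1 := Ideal.mem_comap.mp (h𝔭.mem_of_pow_mem 2 ((Ideal.unit_mul_mem_iff_mem _ (hu12 _)).mp h))
          rw [RingHom.comp_apply, RingEquiv.toRingHom_eq_coe, RingEquiv.coe_toRingHom, hb1] at h1
          exact hX1 h1
        have hdn : pderiv 1 (X 1 ^ 2 + X 0 ^ 3 : MvPolynomial (Fin 2) k) ∉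
            (Q.comap (Ideal.Quotient.mk (Ideal.span {g₀}))).comap (Ψ.symm.toRingHom.comp C) := by
          have e : pderiv 1 (X 1 ^ 2 + X 0 ^ 3 : MvPolynomial (Fin 2) k) = 2 * X 1 := by
            simp only [map_add, pderiv_pow, pderiv_X_self, pderiv_X_of_ne (show (0 : Fin 2) ≠ 1 by decide)]; norm_num
          rw [e]; intro h2
          have h1 := Ideal.mem_comap.mp ((Ideal.unit_mul_mem_iff_mem _ (hu2' _)).mp h2)
          rw [RingHom.comp_apply, RingEquiv.toRingHom_eq_coe, RingEquiv.coe_toRingHom, hb1] at h1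
          exact hX1 h1
        exact FedderViaSlicingNotMem.clause_of_sliceCoeff_of_not_mem 5 k Ψ g₀ hg0 Q hy _ hdslice _ (X 1 ^ 2 + X 0 ^ 3) hu 3
          (by norm_num) hcoeff (Or.inr ⟨1, hdn⟩) d hd s hs
      · /- `z, t ∈ P`, `w ∉ P`: slices `z, t`, base `k[x,w,y]`, witness `z⁴t⁴`, coefficient `12y²w⁴φ³` -/
        obtain ⟨Ψ, hΨ0, hΨ1, hΨ2, hΨ3, hΨ4⟩ := RelGddF192ConeData.exists_ztSlicing5 k
        have hy0 : Ψ.symm (X 0) = X 2 := Ψ.symm_apply_eq.mpr hΨ2.symm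
        have hy1 : Ψ.symm (X 1) = X 4 := Ψ.symm_apply_eq.mpr hΨ4.symm
        have hb0 : Ψ.symm (C (X 0)) = X 0 := Ψ.symm_apply_eq.mpr hΨ0.symm
        have hb1 : Ψ.symm (C (X 1)) = X 3 := Ψ.symm_apply_eq.mpr hΨ3.symm
        have hb2 : Ψ.symm (C (X 2)) = X 1 := Ψ.symm_apply_eq.mpr hΨ1.symm
        have hy : ∀ r : Fin 2, Ψ.symm (X r) ∈ Q.comap (Ideal.Quotient.mk (Ideal.span {g₀})) := by
          intro r; fin_cases r
          · exact hy0 ▸ hX2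
          · exact hy1 ▸ hX4
        have hΨg : Ψ g₀ = X 0 ^ 2 + (C (X 2 ^ 2 * X 1 ^ 4) * X 1 ^ 4 + C ((X 2 ^ 2 + X 0 ^ 3) ^ 3)) := by
          rw [hg]; simp only [map_add, map_mul, map_pow, hΨ0, hΨ1, hΨ2, hΨ3, hΨ4]; ring
        have hcoeff : coeff (Finsupp.single (0 : Fin 2) (2 * 2) + Finsupp.single 1 4) (Ψ (g₀ ^ (5 - 1))) =
            (12 * X 2 ^ 2 * X 1 ^ 4) * (X 2 ^ 2 + X 0 ^ 3) ^ 3 := by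
          rw [map_pow, hΨg, show (5 - 1 : ℕ) = 4 from rfl, RelGddF192ConeData.coeff_S23]; ring
        have hdslice : ∀ r : Fin 2, (Finsupp.single (0 : Fin 2) (2 * 2) + Finsupp.single 1 4 : Fin 2 →₀ ℕ) r < 5 := by
          intro r; fin_cases r <;> simp
        haveI h𝔭 : ((Q.comap (Ideal.Quotient.mk (Ideal.span {g₀}))).comap (Ψ.symm.toRingHom.comp C)).IsPrime :=
          Ideal.comap_isPrime _ _
        have hu : (12 * X 2 ^ 2 * X 1 ^ 4 : MvPolynomial (Fin 3) k) ∉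
            (Q.comap (Ideal.Quotient.mk (Ideal.span {g₀}))).comap (Ψ.symm.toRingHom.comp C) := by
          intro h
          rw [mul_assoc] at h
          rcases h𝔭.mem_or_mem ((Ideal.unit_mul_mem_iff_mem _ (hu12 _)).mp h) with h1 | h1
          · have h1' := Ideal.mem_comap.mp (h𝔭.mem_of_pow_mem 2 h1)
            rw [RingHom.comp_apply, RingEquiv.toRingHom_eq_coe, RingEquiv.coe_toRingHom, hb2] at h1'
            exact hX1 h1'
          · have h1' := Ideal.mem_comap.mp (h𝔭.mem_of_pow_mem 4 h1)
            rw [RingHom.comp_apply, RingEquiv.toRingHom_eq_coe, RingEquiv.coe_toRingHom, hb1] at h1'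
            exact hX3 h1'
        have hdn : pderiv 2 (X 2 ^ 2 + X 0 ^ 3 : MvPolynomial (Fin 3) k) ∉
            (Q.comap (Ideal.Quotient.mk (Ideal.span {g₀}))).comap (Ψ.symm.toRingHom.comp C) := by
          have e : pderiv 2 (X 2 ^ 2 + X 0 ^ 3 : MvPolynomial (Fin 3) k) = 2 * X 2 := by
            simp only [map_add, pderiv_pow, pderiv_X_self, pderiv_X_of_ne (show (0 : Fin 3) ≠ 2 by decide)]; norm_num
          rw [e]; intro h2
          have h1 := Ideal.mem_comap.mp ((Ideal.unit_mul_mem_iff_mem _ (hu2' _)).mp h2)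
          rw [RingHom.comp_apply, RingEquiv.toRingHom_eq_coe, RingEquiv.coe_toRingHom, hb2] at h1
          exact hX1 h1
        exact FedderViaSlicingNotMem.clause_of_sliceCoeff_of_not_mem 5 k Ψ g₀ hg0 Q hy _ hdslice _ (X 2 ^ 2 + X 0 ^ 3) hu 3
          (by norm_num) hcoeff (Or.inr ⟨2, hdn⟩) d hd s hs
    · /- `t ∉ P`: then `w ∈ P`; slices `z, w`, base `k[x,y,t]`, witness `z⁴w⁴`, coefficient `12t⁴y²φ³` -/
      have hX3 : (X 3 : MvPolynomial (Fin 5) k) ∈ Q.comap (Ideal.Quotient.mk (Ideal.span {g₀})) := htw.resolve_left hX4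
      obtain ⟨Ψ, hΨ0, hΨ1, hΨ2, hΨ3, hΨ4⟩ := RelGddF008ConeData.exists_xytSlicing5 k
      have hy0 : Ψ.symm (X 0) = X 2 := Ψ.symm_apply_eq.mpr hΨ2.symm
      have hy1 : Ψ.symm (X 1) = X 3 := Ψ.symm_apply_eq.mpr hΨ3.symm
      have hb0 : Ψ.symm (C (X 0)) = X 0 := Ψ.symm_apply_eq.mpr hΨ0.symm
      have hb1 : Ψ.symm (C (X 1)) = X 1 := Ψ.symm_apply_eq.mpr hΨ1.symm
      have hb2 : Ψ.symm (C (X 2)) = X 4 := Ψ.symm_apply_eq.mpr hΨ4.symm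
      have hy : ∀ r : Fin 2, Ψ.symm (X r) ∈ Q.comap (Ideal.Quotient.mk (Ideal.span {g₀})) := by
        intro r; fin_cases r
        · exact hy0 ▸ hX2
        · exact hy1 ▸ hX3
      have hΨg : Ψ g₀ = X 0 ^ 2 + (C (X 2 ^ 4 * X 1 ^ 2) * X 1 ^ 4 + C ((X 1 ^ 2 + X 0 ^ 3) ^ 3)) := by
        rw [hg]; simp only [map_add, map_mul, map_pow, hΨ0, hΨ1, hΨ2, hΨ3, hΨ4]; ring
      have hcoeff : coeff (Finsupp.single (0 : Fin 2) (2 * 2) + Finsupp.single 1 4) (Ψ (g₀ ^ (5 - 1))) =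
          (12 * X 2 ^ 4 * X 1 ^ 2) * (X 1 ^ 2 + X 0 ^ 3) ^ 3 := by
        rw [map_pow, hΨg, show (5 - 1 : ℕ) = 4 from rfl, RelGddF192ConeData.coeff_S23]; ring
      have hdslice : ∀ r : Fin 2, (Finsupp.single (0 : Fin 2) (2 * 2) + Finsupp.single 1 4 : Fin 2 →₀ ℕ) r < 5 := by
        intro r; fin_cases r <;> simp
      haveI h𝔭 : ((Q.comap (Ideal.Quotient.mk (Ideal.span {g₀}))).comap (Ψ.symm.toRingHom.comp C)).IsPrime :=
        Ideal.comap_isPrime _ _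
      have hu : (12 * X 2 ^ 4 * X 1 ^ 2 : MvPolynomial (Fin 3) k) ∉
          (Q.comap (Ideal.Quotient.mk (Ideal.span {g₀}))).comap (Ψ.symm.toRingHom.comp C) := by
        intro h
        rw [mul_assoc] at h
        rcases h𝔭.mem_or_mem ((Ideal.unit_mul_mem_iff_mem _ (hu12 _)).mp h) with h1 | h1
        · have h1' := Ideal.mem_comap.mp (h𝔭.mem_of_pow_mem 4 h1)
          rw [RingHom.comp_apply, RingEquiv.toRingHom_eq_coe, RingEquiv.coe_toRingHom, hb2] at h1'
          exact hX4 h1'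
        · have h1' := Ideal.mem_comap.mp (h𝔭.mem_of_pow_mem 2 h1)
          rw [RingHom.comp_apply, RingEquiv.toRingHom_eq_coe, RingEquiv.coe_toRingHom, hb1] at h1'
          exact hX1 h1'
      have hdn : pderiv 1 (X 1 ^ 2 + X 0 ^ 3 : MvPolynomial (Fin 3) k) ∉
          (Q.comap (Ideal.Quotient.mk (Ideal.span {g₀}))).comap (Ψ.symm.toRingHom.comp C) := by
        have e : pderiv 1 (X 1 ^ 2 + X 0 ^ 3 : MvPolynomial (Fin 3) k) = 2 * X 1 := by
          simp only [map_add, pderiv_pow, pderiv_X_self, pderiv_X_of_ne (show (0 : Fin 3) ≠ 1 by decide)]; norm_num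
        rw [e]; intro h2
        have h1 := Ideal.mem_comap.mp ((Ideal.unit_mul_mem_iff_mem _ (hu2' _)).mp h2)
        rw [RingHom.comp_apply, RingEquiv.toRingHom_eq_coe, RingEquiv.coe_toRingHom, hb1] at h1
        exact hX1 h1
      exact FedderViaSlicingNotMem.clause_of_sliceCoeff_of_not_mem 5 k Ψ g₀ hg0 Q hy _ hdslice _ (X 1 ^ 2 + X 0 ^ 3) hu 3
        (by norm_num) hcoeff (Or.inr ⟨1, hdn⟩) d hd s hs

end Summit.ResolutionOfSingularities.ResolutionOfSingularities.Theorems.FInjectiveMacaulayfication.RelGddF192Cone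

end
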